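import Literature.Analysis.FluidPDE.AdaptedBackwardKernel
import Mathlib.Analysis.SpecialFunctions.Gaussian.FourierTransform

/-!
# Crux `AdaptedKernelExists` (stmt-NavierStokesRegularity-2956), line `nash-entropy-last-block`:
  STUB `stub_kernelLimit`, part 5 — Gaussian envelopes: mass and concentration at the pole

Helper file (lands `--supports stmt-NavierStokesRegularity-2956`) on the proof path of the
registered stub `stub_kernelLimit`.  For a family of nonnegative unit-mass slices
`G(t, ·)`, `t ∈ [t₁, T)`, on `ℝ³` obeying the Gaussian UPPER bound
`G(t, x) ≤ C₁ (T − t)^{-3/2} exp(−‖x − x₀‖²/(C₂ (T − t)))`, the measures `G(t, x) dx`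
CONCENTRATE at `x₀`: `∫ φ G(t) → φ(x₀)` as `t ↑ T` for every bounded continuous `φ`
(`kernelLimit_concentration`).  The proof is the standard `ε/3` argument: near `x₀` continuity of
`φ`, away from `x₀` the explicit Gaussian tail
`∫_{‖z−x₀‖ ≥ η} C₁ h^{-3/2} e^{−‖z−x₀‖²/(C₂h)} dz ≤ C₁ (2πC₂)^{3/2} e^{−η²/(2C₂h)}`
(`kernelLimit_envelope_tail_le`), in which all powers of `h = T − t` cancel
(`kernelLimit_gaussian_integral`: `∫ e^{−‖z−x₀‖²/c} dz = (πc)^{3/2}`).  Also the integral of the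
envelope itself (`kernelLimit_envelope_integral`), used for dominated convergence of the masses.
-/

noncomputable section

open MeasureTheory Set Filter Topology Metric Function Real
open Literature.Analysis.FluidPDE

namespace Summit.NavierStokesRegularity.NavierStokesRegularity.Theorems.AdaptedKernelExists.NashEntropyLastBlock

section Three

/-- **The Gaussian integral on `ℝ³`**: for `c > 0`, `z ↦ e^{−‖z − x₀‖²/c}` is integrable and
`∫ e^{−‖z−x₀‖²/c} dz = (π c)^{3/2}` (Mathlib's `integral_rexp_neg_mul_sq_norm`, translated). -/
theorem kernelLimit_gaussian_integral {c : ℝ} (hc : 0 < c) (x₀ : EuclideanSpace ℝ (Fin 3)) :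
    Integrable (fun z : EuclideanSpace ℝ (Fin 3) => Real.exp (-(‖z - x₀‖ ^ 2) / c)) ∧
      ∫ z : EuclideanSpace ℝ (Fin 3), Real.exp (-(‖z - x₀‖ ^ 2) / c) = (π * c) ^ ((3:ℝ) / 2) := by
  have hform : ∀ z : EuclideanSpace ℝ (Fin 3), Real.exp (-(‖z - x₀‖ ^ 2) / c) = Real.exp (-c⁻¹ * ‖z - x₀‖ ^ 2) :=
    fun z => by congr 1; field_simp
  have hint : ∫ z : EuclideanSpace ℝ (Fin 3), Real.exp (-(‖z - x₀‖ ^ 2) / c) = (π * c) ^ ((3:ℝ) / 2) := by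
    simp_rw [hform]
    rw [integral_sub_right_eq_self (fun v : EuclideanSpace ℝ (Fin 3) => Real.exp (-c⁻¹ * ‖v‖ ^ 2)) x₀,
      GaussianFourier.integral_rexp_neg_mul_sq_norm (inv_pos.2 hc), finrank_euclideanSpace_fin]
    norm_num [div_inv_eq_mul]
  refine ⟨?_, hint⟩
  by_contra hni
  rw [integral_undef hni] at hint
  exact (Real.rpow_pos_of_pos (by positivity) _).ne hint

/-- **Integral of the Gaussian envelope**: for `h > 0`,
`z ↦ C₁ h^{-3/2} e^{−‖z−x₀‖²/(C₂h)}` is integrable with integral `C₁ (πC₂)^{3/2}` — independent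
of `h`. -/
theorem kernelLimit_envelope_integral {C₁ C₂ h : ℝ} (hC₂ : 0 < C₂) (hh : 0 < h) (x₀ : EuclideanSpace ℝ (Fin 3)) :
    Integrable (fun z : EuclideanSpace ℝ (Fin 3) => C₁ * h ^ (-(3:ℝ) / 2) * Real.exp (-(‖z - x₀‖ ^ 2) / (C₂ * h))) ∧
      ∫ z : EuclideanSpace ℝ (Fin 3), C₁ * h ^ (-(3:ℝ) / 2) * Real.exp (-(‖z - x₀‖ ^ 2) / (C₂ * h)) =
        C₁ * (π * C₂) ^ ((3:ℝ) / 2) := by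
  obtain ⟨hi, he⟩ := kernelLimit_gaussian_integral (mul_pos hC₂ hh) x₀
  refine ⟨hi.const_mul _, ?_⟩
  rw [integral_const_mul, he, show π * (C₂ * h) = (π * C₂) * h by ring,
    Real.mul_rpow (by positivity) hh.le]
  have hne : h ^ ((3:ℝ) / 2) ≠ 0 := (Real.rpow_pos_of_pos hh _).ne'
  rw [show (-(3:ℝ) / 2) = -((3:ℝ) / 2) by ring, Real.rpow_neg hh.le]
  field_simp

/-- **Gaussian tail of the envelope**: for `η > 0` and `h > 0`,
`∫_{‖z−x₀‖ ≥ η} C₁ h^{-3/2} e^{−‖z−x₀‖²/(C₂h)} dz ≤ C₁ (2πC₂)^{3/2} e^{−η²/(2C₂h)}` (`C₁ ≥ 0`):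
split `e^{−r²/(C₂h)} = e^{−r²/(2C₂h)} · e^{−r²/(2C₂h)}`, bound the first factor on the exterior
and integrate the second over all of `ℝ³`. -/
theorem kernelLimit_envelope_tail_le {C₁ C₂ h η : ℝ} (hC₁ : 0 ≤ C₁) (hC₂ : 0 < C₂) (hh : 0 < h)
    (hη : 0 < η) (x₀ : EuclideanSpace ℝ (Fin 3)) :
    ∫ z in (ball x₀ η)ᶜ, C₁ * h ^ (-(3:ℝ) / 2) * Real.exp (-(‖z - x₀‖ ^ 2) / (C₂ * h)) ≤
      C₁ * (2 * π * C₂) ^ ((3:ℝ) / 2) * Real.exp (-(η ^ 2) / (2 * C₂ * h)) := by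
  obtain ⟨hi2, he2⟩ := kernelLimit_gaussian_integral (show 0 < 2 * C₂ * h by positivity) x₀
  obtain ⟨hi1, -⟩ := kernelLimit_envelope_integral (C₁ := C₁) hC₂ hh x₀
  have hpt : ∀ z ∈ (ball x₀ η)ᶜ, C₁ * h ^ (-(3:ℝ) / 2) * Real.exp (-(‖z - x₀‖ ^ 2) / (C₂ * h)) ≤
      (C₁ * h ^ (-(3:ℝ) / 2) * Real.exp (-(η ^ 2) / (2 * C₂ * h))) *
        Real.exp (-(‖z - x₀‖ ^ 2) / (2 * C₂ * h)) := by
    intro z hz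
    rw [mem_compl_iff, mem_ball, dist_eq_norm, not_lt] at hz
    have hsq : η ^ 2 ≤ ‖z - x₀‖ ^ 2 := pow_le_pow_left₀ hη.le hz 2
    have e1 : -(‖z - x₀‖ ^ 2) / (C₂ * h) =
        -(‖z - x₀‖ ^ 2) / (2 * C₂ * h) + -(‖z - x₀‖ ^ 2) / (2 * C₂ * h) := by
      field_simp; ring
    have e2 : -(‖z - x₀‖ ^ 2) / (2 * C₂ * h) ≤ -(η ^ 2) / (2 * C₂ * h) := by
      rw [neg_div, neg_div, neg_le_neg_iff]
      exact div_le_div_of_nonneg_right hsq (by positivity)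
    rw [e1, Real.exp_add, ← mul_assoc, mul_assoc (C₁ * h ^ (-(3:ℝ) / 2))]
    have h0 : 0 ≤ C₁ * h ^ (-(3:ℝ) / 2) := by positivity
    calc C₁ * h ^ (-(3:ℝ) / 2) * (Real.exp (-(‖z - x₀‖ ^ 2) / (2 * C₂ * h)) *
          Real.exp (-(‖z - x₀‖ ^ 2) / (2 * C₂ * h)))
        ≤ C₁ * h ^ (-(3:ℝ) / 2) * (Real.exp (-(η ^ 2) / (2 * C₂ * h)) *
          Real.exp (-(‖z - x₀‖ ^ 2) / (2 * C₂ * h))) := by gcongr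
      _ = _ := by ring
  calc ∫ z in (ball x₀ η)ᶜ, C₁ * h ^ (-(3:ℝ) / 2) * Real.exp (-(‖z - x₀‖ ^ 2) / (C₂ * h))
      ≤ ∫ z in (ball x₀ η)ᶜ, (C₁ * h ^ (-(3:ℝ) / 2) * Real.exp (-(η ^ 2) / (2 * C₂ * h))) *
          Real.exp (-(‖z - x₀‖ ^ 2) / (2 * C₂ * h)) :=
        setIntegral_mono_on hi1.integrableOn (hi2.const_mul _).integrableOn
          measurableSet_ball.compl hpt
    _ ≤ ∫ z, (C₁ * h ^ (-(3:ℝ) / 2) * Real.exp (-(η ^ 2) / (2 * C₂ * h))) *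
          Real.exp (-(‖z - x₀‖ ^ 2) / (2 * C₂ * h)) :=
        setIntegral_le_integral (hi2.const_mul _) (Eventually.of_forall fun z => by positivity)
    _ = C₁ * (2 * π * C₂) ^ ((3:ℝ) / 2) * Real.exp (-(η ^ 2) / (2 * C₂ * h)) := by
        rw [integral_const_mul, he2, show π * (2 * C₂ * h) = (2 * π * C₂) * h by ring,
          Real.mul_rpow (by positivity) hh.le,
          show (-(3:ℝ) / 2) = -((3:ℝ) / 2) by ring, Real.rpow_neg hh.le]
        have hne : h ^ ((3:ℝ) / 2) ≠ 0 := (Real.rpow_pos_of_pos hh _).ne'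
        field_simp

/-- **Concentration at the pole from a Gaussian upper bound and unit mass.**  Let
`G(t, ·) ≥ 0`, `t ∈ [t₁, T)`, be integrable of unit mass on `ℝ³` with
`G(t, x) ≤ C₁ (T−t)^{-3/2} e^{−‖x−x₀‖²/(C₂(T−t))}`.  Then for every bounded continuous `φ`,
`∫ φ G(t) → φ(x₀)` as `t ↑ T`: `|∫ φ G(t) − φ(x₀)| ≤ ∫ |φ − φ(x₀)| G(t) ≤ osc_{B(x₀,η)} φ +
2‖φ‖∞ C₁ (2πC₂)^{3/2} e^{−η²/(2C₂(T−t))}`. -/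
theorem kernelLimit_concentration {C₁ C₂ t₁ T : ℝ} {x₀ : EuclideanSpace ℝ (Fin 3)} {G : ℝ → EuclideanSpace ℝ (Fin 3) → ℝ} (hC₁ : 0 < C₁)
    (hC₂ : 0 < C₂) (ht₁ : t₁ < T) (hpos : ∀ t ∈ Ico t₁ T, ∀ x, 0 ≤ G t x)
    (hint : ∀ t ∈ Ico t₁ T, Integrable (G t)) (hmass : ∀ t ∈ Ico t₁ T, ∫ x, G t x = 1)
    (hU : ∀ t ∈ Ico t₁ T, ∀ x,
      G t x ≤ C₁ * (T - t) ^ (-(3:ℝ) / 2) * Real.exp (-(‖x - x₀‖ ^ 2) / (C₂ * (T - t))))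
    {φ : EuclideanSpace ℝ (Fin 3) → ℝ} (hφ : Continuous φ) {M : ℝ} (hM : ∀ x, |φ x| ≤ M) :
    Tendsto (fun t => ∫ x, φ x * G t x) (𝓝[<] T) (𝓝 (φ x₀)) := by
  have hM0 : 0 ≤ M := (abs_nonneg _).trans (hM x₀)
  rw [Metric.tendsto_nhds]
  intro ε hε
  -- continuity of `φ` at `x₀`
  obtain ⟨η, hη, hηφ⟩ : ∃ η : ℝ, 0 < η ∧ ∀ x, ‖x - x₀‖ < η → |φ x - φ x₀| ≤ ε / 3 := by
    obtain ⟨η, hη, h⟩ := Metric.continuousAt_iff.1 (hφ.continuousAt (x := x₀)) (ε / 3) (by positivity)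
    refine ⟨η, hη, fun x hx => le_of_lt ?_⟩
    have := h (show dist x x₀ < η by rwa [dist_eq_norm])
    rwa [Real.dist_eq] at this
  -- the Gaussian tail is small for `t` close to `T`
  set K : ℝ := 2 * M * (C₁ * (2 * π * C₂) ^ ((3:ℝ) / 2)) with hK
  have hK0 : 0 ≤ K := by positivity
  obtain ⟨δ₀, hδ₀, htail⟩ : ∃ δ₀ : ℝ, 0 < δ₀ ∧ ∀ h : ℝ, 0 < h → h < δ₀ →
      K * Real.exp (-(η ^ 2) / (2 * C₂ * h)) < ε / 3 := by
    -- `K e^{-η²/(2C₂h)} ≤ K · (2C₂h/η²)` (`e^{-u} ≤ 1/u ≤ …`): choose `h` small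
    refine ⟨ε / 3 / (K + 1) * (η ^ 2 / (2 * C₂)), by positivity, fun h hh hhδ => ?_⟩
    have hu : 0 < η ^ 2 / (2 * C₂ * h) := by positivity
    have hexp : Real.exp (-(η ^ 2) / (2 * C₂ * h)) ≤ (2 * C₂ * h) / η ^ 2 := by
      rw [neg_div, Real.exp_neg]
      have h1 : η ^ 2 / (2 * C₂ * h) ≤ Real.exp (η ^ 2 / (2 * C₂ * h)) := by
        linarith [Real.add_one_le_exp (η ^ 2 / (2 * C₂ * h))]
      rw [inv_le_comm₀ (Real.exp_pos _) (by positivity), inv_div]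
      exact h1
    have hK1 : K / (K + 1) < 1 := (div_lt_one (by positivity)).2 (by linarith)
    calc K * Real.exp (-(η ^ 2) / (2 * C₂ * h)) ≤ K * ((2 * C₂ * h) / η ^ 2) :=
          mul_le_mul_of_nonneg_left hexp hK0
      _ ≤ K * ((2 * C₂ * (ε / 3 / (K + 1) * (η ^ 2 / (2 * C₂)))) / η ^ 2) := by gcongr
      _ = ε / 3 * (K / (K + 1)) := by field_simp
      _ < ε / 3 * 1 := mul_lt_mul_of_pos_left hK1 (by positivity)
      _ = ε / 3 := mul_one _
  -- the estimate for `t ∈ (max t₁ (T − δ₀), T)`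
  have hev : ∀ᶠ t in 𝓝[<] T, t ∈ Ioo (max t₁ (T - δ₀)) T :=
    Ioo_mem_nhdsLT (max_lt ht₁ (by linarith))
  filter_upwards [hev] with t ht
  have ht₁t : t ∈ Ico t₁ T := ⟨(le_max_left _ _).trans ht.1.le, ht.2⟩
  have hh : 0 < T - t := sub_pos.2 ht.2
  have hhδ : T - t < δ₀ := by linarith [(le_max_right t₁ (T - δ₀)).trans_lt ht.1]
  have hGi := hint t ht₁t
  have hG0 := hpos t ht₁t
  obtain ⟨henv_i, -⟩ := kernelLimit_envelope_integral (C₁ := C₁) hC₂ hh x₀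
  -- `∫ φ G(t) − φ(x₀) = ∫ (φ − φ(x₀)) G(t)`
  have hi1 : Integrable fun x => φ x * G t x :=
    hGi.bdd_mul hφ.aestronglyMeasurable (Eventually.of_forall fun x => by
      rw [Real.norm_eq_abs]; exact hM x)
  have hi2 : Integrable fun x => (φ x - φ x₀) * G t x := by
    have : (fun x => (φ x - φ x₀) * G t x) = fun x => φ x * G t x - φ x₀ * G t x :=
      funext fun x => by ring
    rw [this]; exact hi1.sub (hGi.const_mul _)
  have e1 : (∫ x, φ x * G t x) - φ x₀ = ∫ x, (φ x - φ x₀) * G t x := by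
    calc (∫ x, φ x * G t x) - φ x₀ = (∫ x, φ x * G t x) - ∫ x, φ x₀ * G t x := by
          rw [integral_const_mul, hmass t ht₁t, mul_one]
      _ = ∫ x, (φ x * G t x - φ x₀ * G t x) := (integral_sub hi1 (hGi.const_mul _)).symm
      _ = ∫ x, (φ x - φ x₀) * G t x :=
          integral_congr_ae (Eventually.of_forall fun x => by ring)
  rw [Real.dist_eq, e1]
  -- pointwise bound `|(φ − φ(x₀)) G| ≤ (ε/3) G + 2M · envelope · 1_{‖x−x₀‖ ≥ η}`
  have hpt : ∀ x, |(φ x - φ x₀) * G t x| ≤ ε / 3 * G t x +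
      (ball x₀ η)ᶜ.indicator
        (fun z => 2 * M * (C₁ * (T - t) ^ (-(3:ℝ) / 2) *
          Real.exp (-(‖z - x₀‖ ^ 2) / (C₂ * (T - t))))) x := by
    intro x
    rw [abs_mul, abs_of_nonneg (hG0 x)]
    by_cases hx : x ∈ ball x₀ η
    · rw [indicator_of_notMem (by simpa using hx), add_zero]
      rw [mem_ball, dist_eq_norm] at hx
      exact mul_le_mul_of_nonneg_right (hηφ x hx) (hG0 x)
    · rw [indicator_of_mem (mem_compl hx)]
      have h2M : |φ x - φ x₀| ≤ 2 * M := by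
        calc |φ x - φ x₀| ≤ |φ x| + |φ x₀| := abs_sub _ _
          _ ≤ M + M := add_le_add (hM x) (hM x₀)
          _ = 2 * M := by ring
      calc |φ x - φ x₀| * G t x ≤ 2 * M * G t x := mul_le_mul_of_nonneg_right h2M (hG0 x)
        _ ≤ 2 * M * (C₁ * (T - t) ^ (-(3:ℝ) / 2) *
            Real.exp (-(‖x - x₀‖ ^ 2) / (C₂ * (T - t)))) :=
          mul_le_mul_of_nonneg_left (hU t ht₁t x) (by positivity)
        _ ≤ _ := by
          have : 0 ≤ ε / 3 * G t x := mul_nonneg (by positivity) (hG0 x)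
          linarith
  have hind_i : Integrable ((ball x₀ η)ᶜ.indicator fun z => 2 * M *
      (C₁ * (T - t) ^ (-(3:ℝ) / 2) * Real.exp (-(‖z - x₀‖ ^ 2) / (C₂ * (T - t))))) :=
    ((henv_i.const_mul (2 * M)).indicator measurableSet_ball.compl)
  calc |∫ x, (φ x - φ x₀) * G t x| ≤ ∫ x, |(φ x - φ x₀) * G t x| := abs_integral_le_integral_abs
    _ ≤ ∫ x, (ε / 3 * G t x + (ball x₀ η)ᶜ.indicator (fun z => 2 * M *
          (C₁ * (T - t) ^ (-(3:ℝ) / 2) * Real.exp (-(‖z - x₀‖ ^ 2) / (C₂ * (T - t))))) x) :=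
        integral_mono_of_nonneg (Eventually.of_forall fun x => abs_nonneg _)
          ((hGi.const_mul _).add hind_i) (Eventually.of_forall hpt)
    _ = ε / 3 * (∫ x, G t x) + ∫ x in (ball x₀ η)ᶜ, 2 * M *
          (C₁ * (T - t) ^ (-(3:ℝ) / 2) * Real.exp (-(‖x - x₀‖ ^ 2) / (C₂ * (T - t)))) := by
        rw [integral_add (hGi.const_mul _) hind_i, integral_const_mul,
          integral_indicator measurableSet_ball.compl]
    _ = ε / 3 + 2 * M * ∫ x in (ball x₀ η)ᶜ,
          C₁ * (T - t) ^ (-(3:ℝ) / 2) * Real.exp (-(‖x - x₀‖ ^ 2) / (C₂ * (T - t))) := by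
        rw [hmass t ht₁t, mul_one, integral_const_mul]
    _ ≤ ε / 3 + 2 * M * (C₁ * (2 * π * C₂) ^ ((3:ℝ) / 2) *
          Real.exp (-(η ^ 2) / (2 * C₂ * (T - t)))) := by
        gcongr
        exact kernelLimit_envelope_tail_le hC₁.le hC₂ hh hη x₀
    _ = ε / 3 + K * Real.exp (-(η ^ 2) / (2 * C₂ * (T - t))) := by rw [hK]; ring
    _ < ε / 3 + ε / 3 := by linarith [htail (T - t) hh hhδ]
    _ < ε := by linarith

/-! ### Registered sub-goal -/

/-- **Registered sub-goal `stub_kernelLimit_concentration`** (part 5 of the proof of STUB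
`stub_kernelLimit`): concentration at the pole of unit-mass nonnegative slices under a Gaussian
upper bound. -/
theorem stub_kernelLimit_concentration :
    ∀ (C₁ C₂ t₁ T M : ℝ) (x₀ : EuclideanSpace ℝ (Fin 3)) (G : ℝ → EuclideanSpace ℝ (Fin 3) → ℝ) (φ : EuclideanSpace ℝ (Fin 3) → ℝ), 0 < C₁ → 0 < C₂ → t₁ < T → (∀ t ∈ Ico t₁ T, ∀ x, 0 ≤ G t x) → (∀ t ∈ Ico t₁ T, Integrable (G t)) → (∀ t ∈ Ico t₁ T, ∫ x, G t x = 1) → (∀ t ∈ Ico t₁ T, ∀ x, G t x ≤ C₁ * (T - t) ^ (-(3:ℝ) / 2) * Real.exp (-(‖x - x₀‖ ^ 2) / (C₂ * (T - t)))) → Continuous φ → (∀ x, |φ x| ≤ M) → Tendsto (fun t => ∫ x, φ x * G t x) (𝓝[<] T) (𝓝 (φ x₀)) :=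
  fun _ _ _ _ _ _ _ _ hC₁ hC₂ ht₁ hpos hint hmass hU hφ hM =>
    kernelLimit_concentration hC₁ hC₂ ht₁ hpos hint hmass hU hφ hM

end Three

end Summit.NavierStokesRegularity.NavierStokesRegularity.Theorems.AdaptedKernelExists.NashEntropyLastBlock

end
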